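import Mathlib.Topology.Baire.Lemmas
import Mathlib.Topology.Baire.CompleteMetrizable
import Literature.Geometry.Lorentzian.FinalState
import Literature.Geometry.Lorentzian.Genericity
import HarnessLib

/-!
# Route PhotonSphereChannels · crux `TameCensorship` (stmt-FinalStateConjecture-17431) · line `Sketch`, skeleton v9 ·
# stub `stub_residualTransport`: RESIDUAL escapability transports along a probe-preserving involution (def-free, abstract in r, Q)

Helper file (`--supports stmt-FinalStateConjecture-17431`) of line `Sketch` (lead c4, 2026-08-17, wave 2): one brick of the
RESIDUAL legend. Residual escapability of a property `Q` of initial data at a datum `d`: every compactly supported smooth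
admissible probe through `d` enriches, along an injective linear map of parameter spaces, to one along all of whose further
enrichments a RESIDUAL (comeagre, `residual (EuclideanSpace ℝ (Fin p))`, Mathlib `Topology/GDelta/Basic`) set of radial
directions has `Q` for all small non-zero parameters — the v9 weakening of the open-dense ("robust") legend of v4–v8.
This brick: residual escapability TRANSPORTS along any involution `r` of the data type that carries probes through a
datum to probes through its `r`-image (the intended instance is time reversal `(h, k) ↦ (h, -k)`, which lets the line
read the orientation-blind clause (i) of K3 off the future-going half at the time-reversed datum). It is the exact
residual analogue of the landed open-dense brick `stub_robustTransport`.

Statement: if `r (r D) = D` for all `D`, and `r ∘ G` is a (compactly supported smooth admissible) probe through `r d`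
whenever `G` is one through `d`, then residual escapability of `Q` at `r d` implies residual escapability of `Q ∘ r`
at `d`. Proof: given a probe `G` through `d`, enrich the probe `r ∘ G` through `r d` to `G₁'` along `L`; answer with
`r ∘ G₁'` (a probe through `r (r d) = d`, and `r (G₁' (L c)) = r (r (G c)) = G c`); a further enrichment `G₂` of
`r ∘ G₁'` through `d` gives the further enrichment `r ∘ G₂` of `G₁'` through `r d` (`r (G₂ (L' c)) = r (r (G₁' c)) =
G₁' c`), whose residual set of good directions has `Q (r (G₂ (t • v)))` — the goal; the residual-membership component
is passed through unchanged. Pure logic plus `r ∘ r = id`; no analysis, nothing about `residual` is inspected. [folklore]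
-/

set_option linter.dupNamespace false

open Literature.Geometry.Lorentzian
open scoped Manifold ContDiff Topology
open Filter Set Function

noncomputable section

namespace Summit.FinalStateConjecture.FinalStateConjecture.Theorems.PhotonSphereChannels.TameCensorshipUnwind

/-- **Stub `stub_residualTransport` of line `Sketch` (skeleton v9) for the crux `PhotonSphereChannels.TameCensorship`
(stmt-FinalStateConjecture-17431): residual escapability TRANSPORTS along a probe-preserving involution of the data
type.** Def-free and abstract in `r`, `Q`: if `r (r D) = D` for every datum `D`, and for every datum `d` and every
compactly supported smooth admissible probe `G` through `d` the family `fun c => r (G c)` is such a probe through `r d`,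
then residual escapability of `Q` at `r d` (every probe through `r d` enriches, along an injective linear map of
parameter spaces, to one along all of whose further enrichments a residual set of radial directions has `Q` for all
small non-zero parameters) implies residual escapability of `Q ∘ r` at `d`. Proof: enrich `r ∘ G` (a probe through
`r d`) to `G₁'` along `L`, pull back to `r ∘ G₁'` (a probe through `r (r d) = d` with `r (G₁' (L c)) = r (r (G c)) =
G c`); a further enrichment `G₂` of `r ∘ G₁'` through `d` along `L'` yields the further enrichment `r ∘ G₂` of `G₁'`
through `r d` (`r (G₂ (L' c)) = r (r (G₁' c)) = G₁' c`), and its residual set of good directions is the required one,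
since its conclusion reads `Q (r (G₂ (t • v)))`. [folklore] -/
theorem stub_residualTransport :
    ∀ (X : Type) [TopologicalSpace X] [ChartedSpace E3 X] [IsManifold (𝓡 3) ∞ X] [T2Space X]
    [SecondCountableTopology X] [ConnectedSpace X] (r : InitialDataSet (𝓡 3) X → InitialDataSet (𝓡 3) X), (∀ D,
    r (r D) = D) → (∀ (d : InitialDataSet (𝓡 3) X) (m : ℕ) (G : EuclideanSpace ℝ (Fin m) → InitialDataSet (𝓡 3)
    X), (InitialDataSet.IsSmoothDataFamily m G ∧ G 0 = d ∧ (∀ c, G c ∈ admissibleVacuumData X) ∧ ∃ K : Set X,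
    IsCompact K ∧ ∀ c, ∀ x ∉ K, (G c).h.inner x = d.h.inner x ∧ (G c).k x = d.k x) →
    (InitialDataSet.IsSmoothDataFamily m (fun c => r (G c)) ∧ r (G 0) = r d ∧ (∀ c, r (G c) ∈
    admissibleVacuumData X) ∧ ∃ K : Set X, IsCompact K ∧ ∀ c, ∀ x ∉ K, (r (G c)).h.inner x = (r d).h.inner x ∧
    (r (G c)).k x = (r d).k x)) → ∀ (d : InitialDataSet (𝓡 3) X) (Q : InitialDataSet (𝓡 3) X → Prop), (∀ (m : ℕ)
    (G : EuclideanSpace ℝ (Fin m) → InitialDataSet (𝓡 3) X), (InitialDataSet.IsSmoothDataFamily m G ∧ G 0 = r d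
    ∧ (∀ c, G c ∈ admissibleVacuumData X) ∧ ∃ K : Set X, IsCompact K ∧ ∀ c, ∀ x ∉ K, (G c).h.inner x = (r
    d).h.inner x ∧ (G c).k x = (r d).k x) → ∃ (n : ℕ) (G₁ : EuclideanSpace ℝ (Fin n) → InitialDataSet (𝓡 3) X)
    (L : EuclideanSpace ℝ (Fin m) →ₗ[ℝ] EuclideanSpace ℝ (Fin n)), Function.Injective L ∧
    (InitialDataSet.IsSmoothDataFamily n G₁ ∧ G₁ 0 = r d ∧ (∀ c, G₁ c ∈ admissibleVacuumData X) ∧ ∃ K : Set X,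
    IsCompact K ∧ ∀ c, ∀ x ∉ K, (G₁ c).h.inner x = (r d).h.inner x ∧ (G₁ c).k x = (r d).k x) ∧ (∀ c, G₁ (L c) =
    G c) ∧ ∀ (p : ℕ) (G₂ : EuclideanSpace ℝ (Fin p) → InitialDataSet (𝓡 3) X) (L' : EuclideanSpace ℝ (Fin n)
    →ₗ[ℝ] EuclideanSpace ℝ (Fin p)), Function.Injective L' → (InitialDataSet.IsSmoothDataFamily p G₂ ∧ G₂ 0 = r
    d ∧ (∀ c, G₂ c ∈ admissibleVacuumData X) ∧ ∃ K : Set X, IsCompact K ∧ ∀ c, ∀ x ∉ K, (G₂ c).h.inner x = (r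
    d).h.inner x ∧ (G₂ c).k x = (r d).k x) → (∀ c, G₂ (L' c) = G₁ c) → ∃ U : Set (EuclideanSpace ℝ (Fin p)), U ∈
    residual (EuclideanSpace ℝ (Fin p)) ∧ ∀ v ∈ U, ∃ δ : ℝ, 0 < δ ∧ ∀ t : ℝ, t ≠ 0 → |t| < δ → Q (G₂ (t • v))) →
    ∀ (m : ℕ) (G : EuclideanSpace ℝ (Fin m) → InitialDataSet (𝓡 3) X), (InitialDataSet.IsSmoothDataFamily m G ∧
    G 0 = d ∧ (∀ c, G c ∈ admissibleVacuumData X) ∧ ∃ K : Set X, IsCompact K ∧ ∀ c, ∀ x ∉ K, (G c).h.inner x =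
    d.h.inner x ∧ (G c).k x = d.k x) → ∃ (n : ℕ) (G₁ : EuclideanSpace ℝ (Fin n) → InitialDataSet (𝓡 3) X) (L :
    EuclideanSpace ℝ (Fin m) →ₗ[ℝ] EuclideanSpace ℝ (Fin n)), Function.Injective L ∧
    (InitialDataSet.IsSmoothDataFamily n G₁ ∧ G₁ 0 = d ∧ (∀ c, G₁ c ∈ admissibleVacuumData X) ∧ ∃ K : Set X,
    IsCompact K ∧ ∀ c, ∀ x ∉ K, (G₁ c).h.inner x = d.h.inner x ∧ (G₁ c).k x = d.k x) ∧ (∀ c, G₁ (L c) = G c) ∧ ∀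
    (p : ℕ) (G₂ : EuclideanSpace ℝ (Fin p) → InitialDataSet (𝓡 3) X) (L' : EuclideanSpace ℝ (Fin n) →ₗ[ℝ]
    EuclideanSpace ℝ (Fin p)), Function.Injective L' → (InitialDataSet.IsSmoothDataFamily p G₂ ∧ G₂ 0 = d ∧ (∀
    c, G₂ c ∈ admissibleVacuumData X) ∧ ∃ K : Set X, IsCompact K ∧ ∀ c, ∀ x ∉ K, (G₂ c).h.inner x = d.h.inner x
    ∧ (G₂ c).k x = d.k x) → (∀ c, G₂ (L' c) = G₁ c) → ∃ U : Set (EuclideanSpace ℝ (Fin p)), U ∈ residual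
    (EuclideanSpace ℝ (Fin p)) ∧ ∀ v ∈ U, ∃ δ : ℝ, 0 < δ ∧ ∀ t : ℝ, t ≠ 0 → |t| < δ → Q (r (G₂ (t • v))) := by
  intro X _ _ _ _ _ _ r hrr hP d Q h m G hG
  obtain ⟨n, G₁', L, hL, hG₁', hLG, hR⟩ := h m (fun c => r (G c)) (hP d m G hG)
  have h' := hP (r d) n G₁' hG₁'
  rw [hrr] at h'
  refine ⟨n, fun c => r (G₁' c), L, hL, h', fun c => ?_, fun p G₂ L' hL' hG₂ hL'G => ?_⟩
  · show r (G₁' (L c)) = G c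
    rw [hLG, hrr]
  · exact hR p (fun c => r (G₂ c)) L' hL' (hP d p G₂ hG₂)
      (fun c => by show r (G₂ (L' c)) = G₁' c; rw [hL'G, hrr])

end Summit.FinalStateConjecture.FinalStateConjecture.Theorems.PhotonSphereChannels.TameCensorshipUnwind

end
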